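import Summits.ResolutionOfSingularities.ResolutionOfSingularities.Theorems.PurelyInseparableDim4ResConeFourWeightsRecurrence
import HarnessLib
import HarnessLib.Audit.Tags

/-!
# Purely inseparable four-folds — the D∞ HEAVY-LINE ASSEMBLY at `(p,d) = (5,4)` IN ABSTRACT POTENTIAL FORM: a frame-carried potential
# that drops strictly at `(2)`-states and weakly at `(2,1)`-states kills the D∞ branch (cell `res-dim4-pi`, K2(p) lane, slice C
# `(5,4)` TAIL-D; the `μ = 4` twin of the holder's brick A `…ResConeBInfPotential` for CARD I-1-9/I-1-10 «THE HEAVY LINE»)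

[OURS · counted 0 · cell `res-dim4-pi` · K2(p) lane (holder res-dim4-p-12 g4); twin of `ResCone.no_bInf_tail_of_potential` (p702997)
for the D∞ branch of W₄ `four_weights_dichotomy` (p702207); kernel hand res-dim4-p-7 g5.]  Nothing here proves TAIL-D, K2(5)
(`RidgeBudget.NoAboveFloorTrap 5 5`), `NoIsolatedTrap 5 5` or resolution of singularities in dimension ≥ 4 / characteristic `p` — NOT
proved; the three frame laws (E₄)/(K₄)/(L₄) are HYPOTHESES here (the heavy line's stubs: entry at a `(2,1)`-state, KEEP-H at a
`(2)`-state = `ResCone.dInf_stub_keep`, LOSE-H at a `(2,1)`-state).  AI kernel work, weaker than expert review.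

The heavy-line assembly never looks inside the carried label: along a witnessed isolated above-floor `Step0 5` chain of constant shade
`4` with `x^{r₀} ∣ F₀`, on the D∞ branch from `k₁` (one weight-`2` letter, the others `≤ 1`, `|r| ∈ {2,3}` — the second disjunct of
`four_weights_dichotomy` VERBATIM), for an ARBITRARY datum type `Fr`, predicates `E R : ℕ → Fr → Prop` and potential `Φ : ℕ → Fr → ℕ`:
* **`no_dInf_tail_of_potential`** — (E₄) at every `(2,1)`-state (`|r_k| = 3`) an entry datum exists; (L₄) at every `(2,1)`-state an
  entry datum yields a run datum of the child with `Φ` not larger; (K₄) at every `(2)`-state (`|r_k| = 2`) a run datum yields a run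
  datum of the child with `Φ` STRICTLY smaller; (RE) run data are entry data ⟹ `False`: a `(2,1)`-state `kₑ ≥ k₁` exists
  (`exists_degree_three₄`, W₄′ p702609), the data propagate with `#(2)-states so far + Φ ≤ Φ₀`, and a bounded number of `(2)`-states
  contradicts W₄'s dock `no_four_tail_of_degree_two_budget`;
* **`tailD_of_lightPair_of_potential`** — hence the socket's TAIL-D block for the chain, GIVEN a kill of the LIGHT-PAIR branch `(1,1)`
  (hN4-C′'s business) and the four hypotheses on every D∞ branch (by `four_weights_dichotomy`) — the re-presentation-free
  alternative to `no_dInf_tail_of_representation (hN4D) (hpair)`.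
INSTANTIATION (when the stubs land): `Fr := Fin 4 × (Fin (2+2) → Fin 4 → K) × (Fin 4 → Fin (2+2) → K)` (heavy letter + linear frame +
left inverse), `E/R :=` entry/run invariants with `u₁ = e_h`, `r h = 2`, y-rows annihilating `resVertex`, polygon at level `4` with
`pts ≠ ∅`, `4! < δs`, `2·αs ≤ 4!`, `0 < αs`; `Φ := betaS`; (K₄) = `ResCone.dInf_stub_keep`.

[cite: CossartJannsenSaito2020, Thm. 3.14, Lemma 13.4, Thm. 13.7] [cite: HauserPerlega2019PRIMS, §2 (transform D′ of D)]
bears_on: LADDER-RESOLUTION:D157-DOOR2 (res-dim4-pi · K2(p) · slice C `(5,4)` D∞ heavy-line assembly, abstract).  Supports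
stmt-ResolutionOfSingularities-16155 (helper).
-/

set_option linter.dupNamespace false -- mandated namespace of this single-conjunct summit

noncomputable section

namespace Summit.ResolutionOfSingularities.ResolutionOfSingularities.Theorems.PIDim4

namespace ResCone

open MvPolynomial Finset
open Literature.AlgebraicGeometry.Resolution
open Literature.AlgebraicGeometry.Resolution.CentreBlowup
open Literature.AlgebraicGeometry.Resolution.Hauser2010
open Literature.AlgebraicGeometry.Resolution.HauserPerlega2019

variable {K : Type} [Field K] [CharP K 5] [DecidableEq K]

/-- **THE D∞ HEAVY-LINE ASSEMBLY IN POTENTIAL FORM.**  Along a witnessed isolated above-floor `Step0 5` chain with `x^{r₀} ∣ F₀` and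
constant shade `4` from `k₀`, on the D∞ branch from `k₁ ≥ k₀` (one weight-`2` letter, the others `≤ 1`, `2 ≤ |r_k| ≤ 3`): suppose a datum
type `Fr` with ENTRY/RUN predicates `E R` and a potential `Φ` satisfies: (E₄) at every `(2,1)`-state (`|r_k| = 3`) an entry datum exists;
(L₄) at every `(2,1)`-state an entry datum yields a run datum of the child with `Φ` not larger; (K₄) at every `(2)`-state (`|r_k| = 2`) a
run datum yields a run datum of the child with `Φ` strictly smaller; (RE) run data are entry data.  Then `False`. [OURS]
[cite: CossartJannsenSaito2020, Thm. 3.14, Thm. 13.7] -/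
theorem no_dInf_tail_of_potential {c : ℕ → State K} {j : ℕ → Fin 4} {b : ℕ → Fin 4 → K}
    (hc : ∀ k, IsIsolated 5 (c k).F ∧ Step0 5 (c k) (c (k + 1))) (hw : FreeTail.IsWitnessedChain 5 c j b)
    (hr0 : ∀ e ∈ (c 0).F.support, (c 0).r ≤ e) (hfloor : ∀ k, ordZero (c k).F ≠ 5) {k₀ : ℕ}
    (hshade : ∀ k, k₀ ≤ k → (c k).shade = ((4 : ℕ) : ℕ∞)) {k₁ : ℕ} (hk₁ : k₀ ≤ k₁)
    (hD : ∀ k, k₁ ≤ k → (∃ W, (c k).r W = 2 ∧ ∀ i, i ≠ W → (c k).r i ≤ 1) ∧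
      (2 ≤ (c k).r.degree ∧ (c k).r.degree ≤ 3))
    {Fr : Type} (E R : ℕ → Fr → Prop) (Φ : ℕ → Fr → ℕ)
    (hE : ∀ k, k₁ ≤ k → (c k).r.degree = 3 → ∃ f, E k f)
    (hL : ∀ k, k₁ ≤ k → (c k).r.degree = 3 → ∀ f, E k f → ∃ f', R (k + 1) f' ∧ Φ (k + 1) f' ≤ Φ k f)
    (hK : ∀ k, k₁ ≤ k → (c k).r.degree = 2 → ∀ f, R k f → ∃ f', R (k + 1) f' ∧ Φ (k + 1) f' < Φ k f)
    (hRE : ∀ k f, R k f → E k f) : False := by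
  haveI : Fact (Nat.Prime 5) := ⟨by norm_num⟩
  classical
  have hheavy : ∀ k, k₁ ≤ k → ∃ W, (c k).r W = 2 := fun k hk => by
    obtain ⟨⟨W, hW, -⟩, -⟩ := hD k hk; exact ⟨W, hW⟩
  -- an entry `(2,1)`-state `kₑ ≥ k₁`
  obtain ⟨kₑ, hkₑ, h3⟩ := exists_degree_three₄ hc hw hr0 hfloor hshade hk₁ hheavy k₁ le_rfl
  obtain ⟨fₑ, hfₑ⟩ := hE kₑ hkₑ h3
  obtain ⟨f₀, hR₀, -⟩ := hL kₑ hkₑ h3 fₑ hfₑ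
  -- propagate: at time `kₑ + 1 + n` a run datum with `#(2)-states so far + Φ ≤ Φ₀`
  have hprop : ∀ n, ∃ f, R (kₑ + 1 + n) f ∧
      ((Finset.range n).filter (fun i => (c (kₑ + 1 + i)).r.degree = 2)).card + Φ (kₑ + 1 + n) f ≤ Φ (kₑ + 1) f₀ := by
    intro n
    induction n with
    | zero => exact ⟨f₀, by simpa using hR₀, by simp⟩
    | succ n ih =>
      obtain ⟨f, hRf, hbound⟩ := ih
      have hk : k₁ ≤ kₑ + 1 + n := by omega
      have hcard : ((Finset.range (n + 1)).filter (fun i => (c (kₑ + 1 + i)).r.degree = 2)).card =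
          ((Finset.range n).filter (fun i => (c (kₑ + 1 + i)).r.degree = 2)).card +
            (if (c (kₑ + 1 + n)).r.degree = 2 then 1 else 0) := by
        rw [Finset.range_add_one, Finset.filter_insert]
        split_ifs with h2
        · rw [Finset.card_insert_of_notMem (by simp)]
        · rfl
      have heq : kₑ + 1 + (n + 1) = kₑ + 1 + n + 1 := by ring
      obtain ⟨-, hge2, hle3⟩ := hD (kₑ + 1 + n) hk
      by_cases h2 : (c (kₑ + 1 + n)).r.degree = 2
      · obtain ⟨f', hR', hlt⟩ := hK _ hk h2 f hRf
        refine ⟨f', by rw [heq]; exact hR', ?_⟩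
        rw [hcard, if_pos h2, heq]
        omega
      · have h3' : (c (kₑ + 1 + n)).r.degree = 3 := by omega
        obtain ⟨f', hR', hle⟩ := hL _ hk h3' f (hRE _ _ hRf)
        refine ⟨f', by rw [heq]; exact hR', ?_⟩
        rw [hcard, if_neg h2, heq]
        omega
  -- the `(2)`-visit budget, then W₄'s dock
  refine no_four_tail_of_degree_two_budget hc hw hr0 hfloor hshade (k₁ := kₑ + 1) (by omega)
    (B := Φ (kₑ + 1) f₀) fun n => ?_
  obtain ⟨f, -, hbound⟩ := hprop n
  omega

/-- **TAIL-D FROM A LIGHT-PAIR KILL AND THE THREE HEAVY-LINE FRAME LAWS (potential form).**  Along a witnessed isolated above-floor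
`Step0 5` chain with `x^{r₀} ∣ F₀` and constant shade `4` from `k₀`: if the LIGHT-PAIR branch (all weights `≤ 1`, `|r_k| = 2` for every
`k ≥ k₀`) is contradictory, and for every `k₁ ≥ k₀` with the D∞ branch from `k₁` some datum type carries (E₄)/(L₄)/(K₄)/(RE) as in
`no_dInf_tail_of_potential`, then `False` — i.e. the chain satisfies the socket's TAIL-D (the re-presentation-free alternative to
`no_dInf_tail_of_representation`). [OURS] [cite: CossartJannsenSaito2020, Thm. 3.14, Thm. 13.7] -/
theorem tailD_of_lightPair_of_potential {c : ℕ → State K} {j : ℕ → Fin 4} {b : ℕ → Fin 4 → K}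
    (hc : ∀ k, IsIsolated 5 (c k).F ∧ Step0 5 (c k) (c (k + 1))) (hw : FreeTail.IsWitnessedChain 5 c j b)
    (hr0 : ∀ e ∈ (c 0).F.support, (c 0).r ≤ e) (hfloor : ∀ k, ordZero (c k).F ≠ 5) {k₀ : ℕ}
    (hshade : ∀ k, k₀ ≤ k → (c k).shade = ((4 : ℕ) : ℕ∞))
    (hlight : (∀ k, k₀ ≤ k → (∀ i, (c k).r i ≤ 1) ∧ (c k).r.degree = 2) → False)
    (hframes : ∀ k₁, k₀ ≤ k₁ → (∀ k, k₁ ≤ k → (∃ W, (c k).r W = 2 ∧ ∀ i, i ≠ W → (c k).r i ≤ 1) ∧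
        (2 ≤ (c k).r.degree ∧ (c k).r.degree ≤ 3)) →
      ∃ (Fr : Type) (E R : ℕ → Fr → Prop) (Φ : ℕ → Fr → ℕ),
        (∀ k, k₁ ≤ k → (c k).r.degree = 3 → ∃ f, E k f) ∧
        (∀ k, k₁ ≤ k → (c k).r.degree = 3 → ∀ f, E k f → ∃ f', R (k + 1) f' ∧ Φ (k + 1) f' ≤ Φ k f) ∧
        (∀ k, k₁ ≤ k → (c k).r.degree = 2 → ∀ f, R k f → ∃ f', R (k + 1) f' ∧ Φ (k + 1) f' < Φ k f) ∧
        (∀ k f, R k f → E k f)) : False := by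
  rcases four_weights_dichotomy hc hw hr0 hfloor hshade with hL | ⟨k₁, hk₁, hB⟩
  · exact hlight hL
  · obtain ⟨Fr, E, R, Φ, hE, hL', hK, hRE⟩ := hframes k₁ hk₁ hB
    exact no_dInf_tail_of_potential hc hw hr0 hfloor hshade hk₁ hB E R Φ hE hL' hK hRE

end ResCone

end Summit.ResolutionOfSingularities.ResolutionOfSingularities.Theorems.PIDim4

end
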